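import Mathlib
import Literature.Analysis.FluidPDE.MildSolution
import Literature.Analysis.FluidPDE.LerayHopf
import Literature.Claims.NS.ClayVariants
import Literature.Analysis.FluidPDE.BoundedLerayHopfClay
import Literature.Analysis.FluidPDE.ClayClassLerayHopfUniqueness
import Literature.Analysis.FluidPDE.NSLerayExistenceR3Holds
import HarnessLib

/-!
# Claim skeleton (D-0090 NS-CLAIMS, C19): Cui, arXiv:1204.5040v2 (2012, withdrawn 2015) — global
# well-posedness of 3D Navier–Stokes in `L^p ∩ L²`, `3 < p < ∞`, by "continuous induction"

Typed skeleton of S. Cui, *Global well-posedness of the 3-dimensional Navier–Stokes initial value problem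
in `L^p ∩ L²` with `3 < p < ∞`*, arXiv:1204.5040 **v2** (24 Apr 2012, 17 pp.; text of record), bib
`Cui2012NSLpWithdrawn`; v3 (5 May 2015) is the author's withdrawal: "withdrawn by the author due to a
crucial error in the proof of the main result" (the error is not localised there). Page numbers are the v2 PDF
pages. Viscosity is normalised to `1` and the force is `0` ((1.1), p. 1). NOTHING here asserts a step: the
paper's statements are `def … : Prop`; the theorems are kernel relations only.

ORDERED STEP INDEX (dependency order; `claim_of_steps` takes Steps 1–7 in this order):
* Step 1 = `Theorem11` (p. 3, "Theorem 1.1", the classical `L^p` theory the paper imports from Kato [12]: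
  uniqueness, global-or-maximal existence with the blow-up alternative (2), continuous dependence (p. 4 (6),
  used on p. 14 in `C([0,T], L^p ∩ L²)` form)) — classical + cite.
* Step 2 = `Lemma22` (p. 8: small `‖u₀‖₃` ⇒ global, with (3) `∫₀^∞ ‖u‖_p^{p(p−1)/(p−3)} ≤ C‖u₀‖₃^{2p/(p−3)}‖u₀‖_p^p`).
* Step 3 = `Lemma23` (pp. 9–10: IF (2.8) with a constant `C[κ_p(u₀)]` THEN (2.9) `sup_t ‖u‖_p^p ≤ C̃[κ_p(u₀)]‖u₀‖_p^p`
  "for some similar but possibly larger constant").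
* Step 4 = `Lemma32` (p. 12: perturbation of a global solution `v` satisfying (3.1); estimate (3.8) for
  `w = u − v` with a constant `C[κ_p(v₀)]`).
* Step 5 = `Assertion1Printed p C` (p. 14 l. 3–12: "`G_p` is open", typed AS PRINTED: a neighbourhood of `0`
  (l. 4–5) + RELATIVE `ε`-closeness `‖u₀ − v₀‖_p ≤ ε‖v₀‖_p`, `‖u₀ − v₀‖₂ ≤ ε‖v₀‖₂` with `ε = ε(v₀)` (l. 8–10);
  `Assertion1 p C` is the v1 absolute-ball variant, same topology) and Step 6 = `Assertion2 p C` (p. 14 l. 12–22: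
  "`G_p` is closed", sequential), for the set `goodSet p C` = `G_p` of (4.1) p. 13 READ WITH A FIXED CONSTANT
  FUNCTION `C : ℝ → ℝ` ("`C[κ_p(u₀)]` … depending only on `κ_p(u₀) (not on specific u₀)`", Thm 1.3 p. 5 and (3.1)
  p. 10) — the FIXED reading (R1); Steps 5′/6′ = `Assertion1ExistsPrinted p` (v1: `Assertion1Exists p`) /
  `Assertion2Exists p` for `goodSetExists p` (= "global solution with `∫₀^∞‖u‖_p^{p(p−1)/(p−3)} < ∞`", constant
  allowed to depend on `u₀`) — the EXISTENTIAL reading (R2). The print does not fix `C[·]` anywhere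
  (TYPING-HYGIENE 4/F11: both readings typed; the referee picks). ABSTRACT GRAIN (F15): `Assertion1Inference`
  (the real-number inference of p. 14 l. 10–12 in the quantifier order base → `ε₀` → perturbation, agreed by
  refuter-8 / ref-4 17:42–17:45Z) and `Assertion2Inference` (p. 14 l. 17, R2 only).
* Step 7 = `ContinuousInductionPrinted p G` (p. 14 l. 23–24: "Having proved the above two assertions, we conclude
  that `G_p = L^p_ω ∩ L²_ω`": zero neighbourhood + relative openness + sequential closedness ⇒ everything;
  classical, segment `s ↦ s·u₀`; `ContinuousInduction p G` is the v1 absolute-ball variant).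
* HEADLINE = `ClaimedTheorem` (Theorem 1.3, p. 5); `claim_of_steps_printed` (and the v1 `claim_of_steps`) PROVED
  (pure logic, fixed reading). `globalExistence_of_steps_exists_printed` (v1: `globalExistence_of_steps_exists`):
  the existential reading composes only to `GlobalExistence p` (every datum has a global
  `L^p ∩ L²`-solution), NOT to the uniform bound (1.3) — the missing implication is
  `(∀ u₀ ∃ C) → (∃ C ∀ u₀)` (recorded, not asserted).
* CLAY LINK: `Corollary16` (p. 6: `u₀ ∈ H^∞`, `div u₀ = 0` ⇒ the Leray–Hopf weak solution is `C^∞(ℝ³ × [0,∞))`,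
  typed over the tree's `IsGlobalLerayHopf`) is the (A)-shaped consequence; `ClayDelta` = the exact extra
  hypotheses turning it into `ClayVariants.clayR3.RegularityAt 1`: the tree's named fact `leray_existence_R3`
  (Leray 1934) and "smooth Leray–Hopf representative ⇒ smooth pressure with (1)–(3) and energy bound (7)" — both
  classical, neither in the printed sentence (Δ5 SOLUTION NOTION); `clay_of_corollary16_of_delta` PROVED (Clay
  data are `H^∞`: `memLp_iteratedFDeriv_of_hasRapidSpatialDecay`, proved). All `ν > 0` then follow in the tree
  from `ClayVariants.clayR3_regularityAt_iff` (ν-scaling), not restated here. APPEND (lit-4 g6, 2026-08-27):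
  `clayDelta_holds : ClayDelta` — BOTH conjuncts are theorems of the tree (`leray_existence_R3_holds`; the smooth
  representative coincides on `t ≥ 0` with the Clay solution of `clay_solution_of_locallyBounded_globalLerayHopf`,
  `BoundedLerayHopfClay.lean`, by `IsNavierStokesSolution.ae_eq_of_isLerayHopfOn` and continuity), hence the
  unconditional link `clay_of_corollary16 : Corollary16 → ClayVariants.clayR3.Regularity`.

WHAT THIS IS NOT: not a claim about NS regularity or blow-up; not a claim about any author beyond the typed
locator.
-/

noncomputable section

open Set Function Filter MeasureTheory
open scoped Topology ENNReal ContDiff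

namespace Literature.Claims.NS.Cui2012

open Literature.Analysis.FluidPDE

/-! ### Vocabulary of the paper (pp. 3, 5, 7, 13) over the tree's mild-solution predicates -/

/-- `‖f‖_q` as an extended real (`eLpNorm` w.r.t. Lebesgue measure), the paper's `‖·‖_q` (p. 3).
[cite: Cui2012NSLpWithdrawn, §1 p.3] -/
def lpNorm (q : ℝ) (f : EuclideanSpace ℝ (Fin 3) → EuclideanSpace ℝ (Fin 3)) : ℝ≥0∞ :=
  eLpNorm f (ENNReal.ofReal q) volume

/-- The data space `L^p_ω(ℝ³) ∩ L²_ω(ℝ³)` (p. 3: "`L^p_ω = {u₀ ∈ L^p : div u₀ = 0}`"; divergence in the weak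
sense, tree `IsWeaklyDivFree`). [cite: Cui2012NSLpWithdrawn, §1 p.3] -/
def IsData (p : ℝ) (u₀ : EuclideanSpace ℝ (Fin 3) → EuclideanSpace ℝ (Fin 3)) : Prop :=
  MemLp u₀ (ENNReal.ofReal p) volume ∧ MemLp u₀ 2 volume ∧ IsWeaklyDivFree u₀

/-- "`L^p ∩ L²`-solution of (1.1) on the time set `S`" (Lemma 2.1 p. 7; Thm 1.1 p. 3: mild solution in
`C([0,T], L^p_ω)`): a mild solution (tree `IsMildNSSolutionOn`, viscosity `1`, force `0`) continuous in time
with values in `L^p` and in `L²` (tree `ContinuousInLpOn`). [cite: Cui2012NSLpWithdrawn, Lemma 2.1 p.7] -/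
structure IsLpL2SolutionOn (p : ℝ) (S : Set ℝ) (u₀ : EuclideanSpace ℝ (Fin 3) → EuclideanSpace ℝ (Fin 3))
    (u : ℝ → EuclideanSpace ℝ (Fin 3) → EuclideanSpace ℝ (Fin 3)) : Prop where
  /-- mild (Duhamel/duality) solution with weakly divergence-free slices -/
  mild : IsMildNSSolutionOn S 1 0 u₀ u
  /-- `u ∈ C(S; L^p)` -/
  continuousInLp : ContinuousInLpOn S (ENNReal.ofReal p) u
  /-- `u ∈ C(S; L²)` -/
  continuousInL2 : ContinuousInLpOn S 2 u

/-- A global `L^p ∩ L²`-solution (time set `[0, ∞)`; Thm 1.3 p. 5: `u ∈ C([0,+∞), L^p_ω ∩ L²_ω)`).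
[cite: Cui2012NSLpWithdrawn, Theorem 1.3 p.5] -/
def IsGlobalSolution (p : ℝ) (u₀ : EuclideanSpace ℝ (Fin 3) → EuclideanSpace ℝ (Fin 3))
    (u : ℝ → EuclideanSpace ℝ (Fin 3) → EuclideanSpace ℝ (Fin 3)) : Prop :=
  IsLpL2SolutionOn p (Ici 0) u₀ u

/-- A maximally extended solution with FINITE lifespan `T` (Thm 1.1 (2) p. 3; p. 14 "the maximally extended
`L^p ∩ L²`-solution … `T*` denotes the lifespan"): a solution on `[0, T)`, `0 < T`, that no solution on a longer
`[0, T')` extends. [cite: Cui2012NSLpWithdrawn, Theorem 1.1 (2) p.3] -/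
def IsMaximalSolution (p : ℝ) (u₀ : EuclideanSpace ℝ (Fin 3) → EuclideanSpace ℝ (Fin 3))
    (u : ℝ → EuclideanSpace ℝ (Fin 3) → EuclideanSpace ℝ (Fin 3)) (T : ℝ) : Prop :=
  0 < T ∧ IsLpL2SolutionOn p (Ico 0 T) u₀ u ∧
    ¬ ∃ (T' : ℝ) (u' : ℝ → EuclideanSpace ℝ (Fin 3) → EuclideanSpace ℝ (Fin 3)),
      T < T' ∧ IsLpL2SolutionOn p (Ico 0 T') u₀ u' ∧ ∀ t ∈ Ico 0 T, u' t =ᵐ[volume] u t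

/-- The `κ_p`-value (p. 5): `κ_p(u₀) = ‖u₀‖_p^{p/(3(p−2))} ‖u₀‖₂^{2(p−3)/(3(p−2))}` (scaling invariant,
`‖u₀‖₃ ≤ κ_p(u₀)`). [cite: Cui2012NSLpWithdrawn, §1 p.5] -/
def kappa (p : ℝ) (u₀ : EuclideanSpace ℝ (Fin 3) → EuclideanSpace ℝ (Fin 3)) : ℝ :=
  (lpNorm p u₀).toReal ^ (p / (3 * (p - 2))) * (lpNorm 2 u₀).toReal ^ (2 * (p - 3) / (3 * (p - 2)))

/-- The time integral of (1.4)/(2.8)/(4.1): `∫₀^∞ ‖u(t)‖_p^{p(p−1)/(p−3)} dt`, as a lower Lebesgue integral in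
`[0, ∞]` (no junk value: divergence = `⊤`). [cite: Cui2012NSLpWithdrawn, (1.4) p.6] -/
def trajectoryIntegral (p : ℝ) (u : ℝ → EuclideanSpace ℝ (Fin 3) → EuclideanSpace ℝ (Fin 3)) : ℝ≥0∞ :=
  ∫⁻ t in Ioi (0 : ℝ), lpNorm p (u t) ^ (p * (p - 1) / (p - 3))

/-- `G_p` of p. 13, FIXED-CONSTANT READING: for a given function `C : ℝ → ℝ` ("`C[κ_p(u₀)]` … depending only
on `κ_p(u₀)`"), the data `u₀` for which (1.1) has a global `L^p ∩ L²`-solution with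
(4.1) `∫₀^∞ ‖u‖_p^{p(p−1)/(p−3)} ≤ C[κ_p(u₀)] ‖u₀‖_p^p`. [cite: Cui2012NSLpWithdrawn, §4 (4.1) p.13] -/
def goodSet (p : ℝ) (C : ℝ → ℝ) : Set (EuclideanSpace ℝ (Fin 3) → EuclideanSpace ℝ (Fin 3)) :=
  {u₀ | IsData p u₀ ∧ ∃ u, IsGlobalSolution p u₀ u ∧
    trajectoryIntegral p u ≤ ENNReal.ofReal (C (kappa p u₀) * (lpNorm p u₀).toReal ^ p)}

/-- `G_p` of p. 13, EXISTENTIAL READING (the constant may depend on `u₀`): global solution with a finite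
trajectory integral. [cite: Cui2012NSLpWithdrawn, §4 (4.1) p.13] -/
def goodSetExists (p : ℝ) : Set (EuclideanSpace ℝ (Fin 3) → EuclideanSpace ℝ (Fin 3)) :=
  {u₀ | IsData p u₀ ∧ ∃ u, IsGlobalSolution p u₀ u ∧ trajectoryIntegral p u < ⊤}

/-- "open (as a subset of `L^p_ω ∩ L²_ω`)" (p. 14), in the `‖·‖_p + ‖·‖₂` topology of the data space, typed by
balls as the proof uses it ("if `u₀` is so close to `v₀` that …"). [cite: Cui2012NSLpWithdrawn, §4 p.14] -/
def IsOpenInData (p : ℝ) (G : Set (EuclideanSpace ℝ (Fin 3) → EuclideanSpace ℝ (Fin 3))) : Prop :=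
  ∀ v₀ ∈ G, ∃ ε : ℝ, 0 < ε ∧ ∀ u₀, IsData p u₀ →
    lpNorm p (u₀ - v₀) < ENNReal.ofReal ε → lpNorm 2 (u₀ - v₀) < ENNReal.ofReal ε → u₀ ∈ G

/-- "closed (as a subset of `L^p_ω ∩ L²_ω`)" (p. 14), typed sequentially as the proof uses it ("let `{u₀ₙ}` be a
sequence in `G_p` converging to `u₀`"). [cite: Cui2012NSLpWithdrawn, §4 p.14] -/
def IsSeqClosedInData (p : ℝ) (G : Set (EuclideanSpace ℝ (Fin 3) → EuclideanSpace ℝ (Fin 3))) : Prop :=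
  ∀ (s : ℕ → EuclideanSpace ℝ (Fin 3) → EuclideanSpace ℝ (Fin 3)) (u₀ : EuclideanSpace ℝ (Fin 3) →
      EuclideanSpace ℝ (Fin 3)), (∀ n, s n ∈ G) → IsData p u₀ →
    Tendsto (fun n => lpNorm p (s n - u₀) + lpNorm 2 (s n - u₀)) atTop (𝓝 0) → u₀ ∈ G

/-! ### The paper's statements (no assertion) -/

/-- **Step 1 — Theorem 1.1 (p. 3; classical `L^p` theory, `p > 3`, imported from Kato [12]) in the form §4 uses
(p. 14)**: (i) uniqueness of `L^p ∩ L²`-solutions on a common time interval (slices agree a.e. — the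
solutions are `L^p`-valued); (ii) every datum has either a global
solution or a maximal one with finite lifespan, and in the latter case `‖u(t)‖_p` is unbounded on `[0, T*)`
(blow-up alternative (2)); (iii) continuous dependence: data converging in `L^p ∩ L²` with global solutions `uₙ`
and a solution `u` of the limit datum on `[0, T)` give `sup_{[0,T']} ‖uₙ − u‖_p → 0` for `T' < T` ((6) p. 4, used on
p. 14 as "`uₙ → u` strongly in `C([0,T], L^p_ω ∩ L²_ω)`"). [cite: Cui2012NSLpWithdrawn, Theorem 1.1 p.3] -/
def Theorem11 (p : ℝ) : Prop :=
  (∀ u₀ (u u' : ℝ → EuclideanSpace ℝ (Fin 3) → EuclideanSpace ℝ (Fin 3)) (T : ℝ),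
      IsLpL2SolutionOn p (Ico 0 T) u₀ u → IsLpL2SolutionOn p (Ico 0 T) u₀ u' →
        ∀ t ∈ Ico 0 T, u' t =ᵐ[volume] u t) ∧
  (∀ u₀, IsData p u₀ → (∃ u, IsGlobalSolution p u₀ u) ∨
      ∃ u T, IsMaximalSolution p u₀ u T ∧ ¬ ∃ M : ℝ, ∀ t ∈ Ico 0 T, lpNorm p (u t) ≤ ENNReal.ofReal M) ∧
  (∀ (s : ℕ → EuclideanSpace ℝ (Fin 3) → EuclideanSpace ℝ (Fin 3)) (us : ℕ → ℝ → EuclideanSpace ℝ (Fin 3) →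
      EuclideanSpace ℝ (Fin 3)) (u₀ : EuclideanSpace ℝ (Fin 3) → EuclideanSpace ℝ (Fin 3))
      (u : ℝ → EuclideanSpace ℝ (Fin 3) → EuclideanSpace ℝ (Fin 3)) (T : ℝ),
      (∀ n, IsGlobalSolution p (s n) (us n)) → IsLpL2SolutionOn p (Ico 0 T) u₀ u →
      Tendsto (fun n => lpNorm p (s n - u₀) + lpNorm 2 (s n - u₀)) atTop (𝓝 0) →
      ∀ T' < T, Tendsto (fun n => ⨆ t ∈ Icc 0 T', lpNorm p (us n t - u t)) atTop (𝓝 0))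

/-- **Step 2 — Lemma 2.2 (p. 8)**: there is `ε > 0` (and `C` depending only on `p`) such that every datum with
`‖u₀‖₃ < ε` has a global `L^p ∩ L²`-solution with (3) `∫₀^∞‖u‖_p^{p(p−1)/(p−3)} ≤ C‖u₀‖₃^{2p/(p−3)}‖u₀‖_p^p`
(assertion (2), monotonicity of the norms, omitted). [cite: Cui2012NSLpWithdrawn, Lemma 2.2 p.8] -/
def Lemma22 (p : ℝ) : Prop :=
  ∃ ε C : ℝ, 0 < ε ∧ 0 < C ∧ ∀ u₀, IsData p u₀ → lpNorm 3 u₀ < ENNReal.ofReal ε →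
    ∃ u, IsGlobalSolution p u₀ u ∧ trajectoryIntegral p u ≤
      ENNReal.ofReal (C * (lpNorm 3 u₀).toReal ^ (2 * p / (p - 3)) * (lpNorm p u₀).toReal ^ p)

/-- **Step 3 — Lemma 2.3 (pp. 9–10), estimate (2.9)**: "Assume that `u` is a global `L^p ∩ L²`-solution … and there
exists a constant `C[κ_p(u₀)] > 0` depending only on `κ_p(u₀)` such that (2.8) … Then for some similar but
possibly larger constant `C[κ_p(u₀)] > 0`" (2.9) `sup_t ‖u(t)‖_p^p ≤ C[κ_p(u₀)]‖u₀‖_p^p` — typed with the two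
constant FUNCTIONS explicit: for every `C` there is `C̃` that works for all data. ((2.10)–(2.13) omitted.)
[cite: Cui2012NSLpWithdrawn, Lemma 2.3 pp.9–10] -/
def Lemma23 (p : ℝ) : Prop :=
  ∀ C : ℝ → ℝ, ∃ Ct : ℝ → ℝ, ∀ u₀ u, IsData p u₀ → IsGlobalSolution p u₀ u →
    trajectoryIntegral p u ≤ ENNReal.ofReal (C (kappa p u₀) * (lpNorm p u₀).toReal ^ p) →
    ∀ t, 0 ≤ t → lpNorm p (u t) ≤ ENNReal.ofReal (Ct (kappa p u₀) * (lpNorm p u₀).toReal)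

/-- **Step 4 — Lemma 3.2 (p. 12) with (3.1) p. 10**: if `v` is a global solution from `v₀` satisfying (3.1) with
the constant `C[κ_p(v₀)]`, then there is `ε > 0` such that every perturbed datum `u₀ = v₀ + w₀`, `‖w₀‖₂ < ε`,
`‖w₀‖_p < ε`, has a global solution `u` with (3.8)
`∫₀^∞‖u − v‖_p^{p(p−1)/(p−3)} ≤ C[κ_p(v₀)](‖w₀‖_p^p + ‖w₀‖₃^p‖v₀‖_p^p)` for "some similar but possibly larger
constant" — typed: for every `C` there is `C'`. ((3.6)–(3.7) omitted.) [cite: Cui2012NSLpWithdrawn, Lemma 3.2 p.12] -/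
def Lemma32 (p : ℝ) : Prop :=
  ∀ C : ℝ → ℝ, ∃ C' : ℝ → ℝ, ∀ v₀ v, IsData p v₀ → IsGlobalSolution p v₀ v →
    trajectoryIntegral p v ≤ ENNReal.ofReal (C (kappa p v₀) * (lpNorm p v₀).toReal ^ p) →
    ∃ ε : ℝ, 0 < ε ∧ ∀ u₀, IsData p u₀ → lpNorm 2 (u₀ - v₀) < ENNReal.ofReal ε →
      lpNorm p (u₀ - v₀) < ENNReal.ofReal ε →
      ∃ u, IsGlobalSolution p u₀ u ∧ trajectoryIntegral p (fun t => u t - v t) ≤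
        ENNReal.ofReal (C' (kappa p v₀) * ((lpNorm p (u₀ - v₀)).toReal ^ p +
          (lpNorm 3 (u₀ - v₀)).toReal ^ p * (lpNorm p v₀).toReal ^ p))

/-- **Step 5 — Assertion 1 (p. 14), fixed-constant reading**: "`G_p` is open"; its last sentence is "The estimate
(4.1) follows from (3.1) and (3.8) by using the inequalities `(1−ε)‖v₀‖_p ≤ ‖u₀‖_p ≤ (1+ε)‖v₀‖_p` and choosing `ε`
sufficiently small" — i.e. membership in `G_p` WITH THE SAME `C[·]` for the perturbed datum.
[claim: Cui2012NSLpWithdrawn, status: disputed] -/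
def Assertion1 (p : ℝ) (C : ℝ → ℝ) : Prop :=
  IsOpenInData p (goodSet p C)

/-- **Step 6 — Assertion 2 (p. 14), fixed-constant reading**: "`G_p` is closed": for `u₀ₙ → u₀` in `G_p`,
"`sup_{0≤t≤T}‖uₙ(t)‖_p ≤ M` … where `M = sup_n C[κ_p(u₀ₙ)]‖u₀ₙ‖_p < ∞`", then `T → T*⁻`: no blow-up, global, and
(4.1) in the limit. [claim: Cui2012NSLpWithdrawn, status: disputed] -/
def Assertion2 (p : ℝ) (C : ℝ → ℝ) : Prop :=
  IsSeqClosedInData p (goodSet p C)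

/-- **Step 5′ — Assertion 1, existential reading** (`G_p` = global solution with finite trajectory integral is
open): the content Lemma 3.2 actually delivers. [claim: Cui2012NSLpWithdrawn, status: disputed] -/
def Assertion1Exists (p : ℝ) : Prop :=
  IsOpenInData p (goodSetExists p)

/-- **Step 6′ — Assertion 2, existential reading**: the same closedness sentence when the constant may depend on
the datum; its line "`M = sup_n C[κ_p(u₀ₙ)]‖u₀ₙ‖_p < ∞`" (p. 14) then has no antecedent.
[claim: Cui2012NSLpWithdrawn, status: disputed] -/
def Assertion2Exists (p : ℝ) : Prop :=
  IsSeqClosedInData p (goodSetExists p)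

/-- **Step 7 — the continuous-induction conclusion (p. 14)**: "Having proved the above two assertions, we
conclude that `G_p = L^p_ω(ℝ³) ∩ L²_ω(ℝ³)`" — with the base point `0 ∈ G_p` (p. 14: "If `v₀ = 0` then by Lemma
2.2 …"; the zero solution), openness and sequential closedness in the (connected) data space give every datum.
Classical (connectedness of a normed space); typed for the set `G`. [cite: Cui2012NSLpWithdrawn, §4 p.14] -/
def ContinuousInduction (p : ℝ) (G : Set (EuclideanSpace ℝ (Fin 3) → EuclideanSpace ℝ (Fin 3))) : Prop :=
  (0 : EuclideanSpace ℝ (Fin 3) → EuclideanSpace ℝ (Fin 3)) ∈ G → IsOpenInData p G → IsSeqClosedInData p G →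
    ∀ u₀, IsData p u₀ → u₀ ∈ G

/-- **HEADLINE — Theorem 1.3 (p. 5), as printed**: "Let `3 < p < ∞`. For any `u₀ ∈ L^p_ω(ℝ³) ∩ L²_ω(ℝ³)` the
problem (1.1) has a unique solution `u ∈ C([0,+∞), L^p_ω ∩ L²_ω)`. Moreover, there exists constant
`C[κ_p(u₀)] > 0` depending only on `κ_p(u₀)` (not on specific `u₀`), such that `sup_{t≥0}‖u(t)‖_p ≤ C[κ_p(u₀)]‖u₀‖_p`
(1.3)." The constant is a FUNCTION of `κ_p` chosen before `u₀` (`∃ C, ∀ u₀`). [claim: Cui2012NSLpWithdrawn, status: disputed] -/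
def ClaimedTheorem : Prop :=
  ∀ p : ℝ, 3 < p →
    (∀ u₀, IsData p u₀ → ∃ u, IsGlobalSolution p u₀ u ∧
      ∀ u', IsGlobalSolution p u₀ u' → ∀ t, 0 ≤ t → u' t =ᵐ[volume] u t) ∧
    ∃ C : ℝ → ℝ, ∀ u₀ u, IsData p u₀ → IsGlobalSolution p u₀ u →
      ∀ t, 0 ≤ t → lpNorm p (u t) ≤ ENNReal.ofReal (C (kappa p u₀) * (lpNorm p u₀).toReal)

/-- Global existence for all data at one exponent `p` — what the EXISTENTIAL reading of §4 reaches (no uniform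
constant). [claim: Cui2012NSLpWithdrawn, status: disputed] -/
def GlobalExistence (p : ℝ) : Prop :=
  ∀ u₀, IsData p u₀ → ∃ u, IsGlobalSolution p u₀ u

/-- **Corollary 1.6 (p. 6)**, the (A)-shaped consequence: for `u₀ ∈ H^∞(ℝ³)` (all derivatives in `L²`; typed for
`C^∞` data with every iterated derivative in `L²`) with `div u₀ = 0`, "the Leray–Hopf weak solution … `u ∈
C^∞(ℝ³ × [0,+∞))`" — typed over the tree's `IsGlobalLerayHopf` (viscosity `1`, force `0`): every global Leray–Hopf
weak solution from such a datum has a representative smooth on the closed half-space with `v(0) = u₀`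
(`v(t) = u(t)` a.e. for every `t ≥ 0`). (A pressure and the energy bound (7) are not part of the printed sentence;
see `ClayDelta`.) [claim: Cui2012NSLpWithdrawn, status: disputed] -/
def Corollary16 : Prop :=
  ∀ u₀ : EuclideanSpace ℝ (Fin 3) → EuclideanSpace ℝ (Fin 3), ContDiff ℝ ∞ u₀ →
    (∀ n : ℕ, MemLp (iteratedFDeriv ℝ n u₀) 2 volume) → NSWave0.IsDivFree u₀ →
    ∀ u : ℝ → EuclideanSpace ℝ (Fin 3) → EuclideanSpace ℝ (Fin 3), IsGlobalLerayHopf 1 0 u₀ u →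
      ∃ v : ℝ → EuclideanSpace ℝ (Fin 3) → EuclideanSpace ℝ (Fin 3),
        IsSmoothOnHalfSpace v ∧ v 0 = u₀ ∧ ∀ t, 0 ≤ t → v t =ᵐ[volume] u t

/-! ### Kernel relations (composition where the printed logic composes) -/

/-- From "every datum lies in `G_p`" (fixed reading) to the headline at exponent `p`: existence + (1.3) via
Lemma 2.3, uniqueness via Theorem 1.1 (i). Pure bookkeeping. [claim: Cui2012NSLpWithdrawn, status: disputed] -/
theorem headline_of_goodSet {p : ℝ} {C : ℝ → ℝ} (h1 : Theorem11 p) (h3 : Lemma23 p)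
    (hall : ∀ u₀, IsData p u₀ → u₀ ∈ goodSet p C) :
    (∀ u₀, IsData p u₀ → ∃ u, IsGlobalSolution p u₀ u ∧
      ∀ u', IsGlobalSolution p u₀ u' → ∀ t, 0 ≤ t → u' t =ᵐ[volume] u t) ∧
    ∃ Ct : ℝ → ℝ, ∀ u₀ u, IsData p u₀ → IsGlobalSolution p u₀ u →
      ∀ t, 0 ≤ t → lpNorm p (u t) ≤ ENNReal.ofReal (Ct (kappa p u₀) * (lpNorm p u₀).toReal) := by
  obtain ⟨huniq, -, -⟩ := h1
  -- uniqueness on `[0, ∞)` from uniqueness on every `[0, T)`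
  have hU : ∀ u₀ u u', IsGlobalSolution p u₀ u → IsGlobalSolution p u₀ u' →
      ∀ t, 0 ≤ t → u' t =ᵐ[volume] u t := by
    intro u₀ u u' hu hu' t ht
    have hres : ∀ w, IsGlobalSolution p u₀ w → IsLpL2SolutionOn p (Ico 0 (t + 1)) u₀ w := fun w hw =>
      ⟨hw.mild.mono Ico_subset_Ici_self, hw.continuousInLp.mono Ico_subset_Ici_self,
        hw.continuousInL2.mono Ico_subset_Ici_self⟩
    exact huniq u₀ u u' (t + 1) (hres u hu) (hres u' hu') t ⟨ht, by linarith⟩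
  obtain ⟨Ct, hCt⟩ := h3 C
  refine ⟨fun u₀ hu₀ => ?_, Ct, fun u₀ u hu₀ hu t ht => ?_⟩
  · obtain ⟨-, u, hu, -⟩ := hall u₀ hu₀
    exact ⟨u, hu, fun u' hu' => hU u₀ u u' hu hu'⟩
  · obtain ⟨-, v, hv, hbound⟩ := hall u₀ hu₀
    have hb := hCt u₀ v hu₀ hv hbound t ht
    have hae : lpNorm p (u t) = lpNorm p (v t) := eLpNorm_congr_ae (hU u₀ v u hv hu t ht)
    rw [hae]
    exact hb

/-- **Composition, FIXED-CONSTANT READING** (Steps 1–7 in order ⇒ `ClaimedTheorem`): for each `p`, with `C` the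
constant function of (4.1), the base point `0 ∈ G_p`, Assertion 1, Assertion 2 and the continuous-induction
conclusion give `G_p = L^p_ω ∩ L²_ω`, whence Theorem 1.3 by `headline_of_goodSet`. Steps 2 and 4 are on the printed
path (they are how the paper argues Step 5) but are not consumed once Step 5 is granted.
[claim: Cui2012NSLpWithdrawn, status: disputed] -/
theorem claim_of_steps
    (h1 : ∀ p : ℝ, 3 < p → Theorem11 p) (_h2 : ∀ p : ℝ, 3 < p → Lemma22 p)
    (h3 : ∀ p : ℝ, 3 < p → Lemma23 p) (_h4 : ∀ p : ℝ, 3 < p → Lemma32 p)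
    (h567 : ∀ p : ℝ, 3 < p → ∃ C : ℝ → ℝ,
      (0 : EuclideanSpace ℝ (Fin 3) → EuclideanSpace ℝ (Fin 3)) ∈ goodSet p C ∧
        Assertion1 p C ∧ Assertion2 p C ∧ ContinuousInduction p (goodSet p C)) :
    ClaimedTheorem := by
  intro p hp
  obtain ⟨C, h0, hA1, hA2, hCI⟩ := h567 p hp
  exact headline_of_goodSet (h1 p hp) (h3 p hp) (hCI h0 hA1 hA2)

/-- **Composition, EXISTENTIAL READING** reaches only `GlobalExistence p`: base point, Assertion 1′, Assertion 2′
and continuous induction on `goodSetExists p`. The uniform bound (1.3) does NOT follow (it would need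
`(∀ u₀ ∃ C) → (∃ C ∀ u₀)`); not asserted. [claim: Cui2012NSLpWithdrawn, status: disputed] -/
theorem globalExistence_of_steps_exists {p : ℝ}
    (h0 : (0 : EuclideanSpace ℝ (Fin 3) → EuclideanSpace ℝ (Fin 3)) ∈ goodSetExists p)
    (hA1 : Assertion1Exists p) (hA2 : Assertion2Exists p) (hCI : ContinuousInduction p (goodSetExists p)) :
    GlobalExistence p := fun u₀ hu₀ => by
  obtain ⟨-, u, hu, -⟩ := hCI h0 hA1 hA2 u₀ hu₀
  exact ⟨u, hu⟩

/-- The fixed reading refines the existential one: `G_p(C) ⊆ G_p(∃)`. [cite: Cui2012NSLpWithdrawn, §4 (4.1) p.13] -/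
theorem goodSet_subset_goodSetExists (p : ℝ) (C : ℝ → ℝ) : goodSet p C ⊆ goodSetExists p := by
  rintro u₀ ⟨hd, u, hu, hb⟩
  exact ⟨hd, u, hu, lt_of_le_of_lt hb ENNReal.ofReal_lt_top⟩

/-! ### Clay link (TYPING-HYGIENE §10 (b)): Corollary 1.6 versus `ClayVariants.clayR3` -/

/-- **`ClayDelta`** — the exact extra hypotheses under which Corollary 1.6 (p. 6) yields Clay (A) at viscosity `1`
(`ClayVariants.clayR3.RegularityAt 1`; axis Δ5 SOLUTION NOTION of `ClayVariants`; both conjuncts are classical and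
are NOT part of the printed corollary): (a) Leray's existence theorem on `ℝ³` — the tree's named fact
`Literature.Analysis.FluidPDE.leray_existence_R3` (every weakly divergence-free `L²` datum has a global
Leray–Hopf solution); (b) a smooth representative `v` of a global Leray–Hopf solution from a Clay datum comes with
a smooth pressure solving (1)–(3) classically and has bounded energy (7). [claim: Cui2012NSLpWithdrawn, status: disputed] -/
def ClayDelta : Prop :=
  Literature.Analysis.FluidPDE.leray_existence_R3 ∧
  ∀ (u₀ : EuclideanSpace ℝ (Fin 3) → EuclideanSpace ℝ (Fin 3))
    (v : ℝ → EuclideanSpace ℝ (Fin 3) → EuclideanSpace ℝ (Fin 3)),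
    ContDiff ℝ ∞ u₀ → NSWave0.IsDivFree u₀ → HasRapidSpatialDecay u₀ →
    IsSmoothOnHalfSpace v → v 0 = u₀ →
    (∃ u, IsGlobalLerayHopf 1 0 u₀ u ∧ ∀ t, 0 ≤ t → v t =ᵐ[volume] u t) →
    ∃ pr : ℝ → EuclideanSpace ℝ (Fin 3) → ℝ,
      IsSmoothOnHalfSpace pr ∧ IsNavierStokesSolution 1 0 u₀ v pr ∧ HasBoundedEnergy v

/-- Clay data are `H^∞` data: a smooth field with rapid decay (4) has every iterated derivative in `L²(ℝ³)`
(`(1+‖x‖)^{-2}`-domination; `(1+‖x‖)^{-r}` is integrable on `ℝ³` for `r > 3`). [cite: FeffermanClay2006, (4) p.1] -/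
theorem memLp_iteratedFDeriv_of_hasRapidSpatialDecay
    {u₀ : EuclideanSpace ℝ (Fin 3) → EuclideanSpace ℝ (Fin 3)} (hs : ContDiff ℝ ∞ u₀)
    (hd : HasRapidSpatialDecay u₀) (n : ℕ) : MemLp (iteratedFDeriv ℝ n u₀) 2 volume := by
  obtain ⟨C, hC⟩ := hd n 2
  have hcont : Continuous (iteratedFDeriv ℝ n u₀) := hs.continuous_iteratedFDeriv (by exact_mod_cast le_top)
  have hC0 : 0 ≤ C := le_trans (by positivity) (hC 0)
  -- pointwise bound `‖Dⁿu₀ x‖ ≤ C (1+‖x‖)^{-2}`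
  have hpt : ∀ x, ‖iteratedFDeriv ℝ n u₀ x‖ ≤ C * (1 + ‖x‖) ^ (-(2 : ℝ)) := by
    intro x
    have h1 : 0 < (1 + ‖x‖) ^ (2 : ℕ) := by positivity
    have h2 := hC x
    rw [Real.rpow_neg (by positivity), ← div_eq_mul_inv, le_div_iff₀ (by positivity)]
    calc ‖iteratedFDeriv ℝ n u₀ x‖ * (1 + ‖x‖) ^ (2 : ℝ)
        = (1 + ‖x‖) ^ (2 : ℕ) * ‖iteratedFDeriv ℝ n u₀ x‖ := by
          rw [mul_comm]; norm_cast
      _ ≤ C := h2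
  -- the majorant is in `L²`: `(C(1+‖x‖)^{-2})² = C²(1+‖x‖)^{-4}`, integrable since `4 > 3 = dim`
  have hmaj : MemLp (fun x : EuclideanSpace ℝ (Fin 3) => C * (1 + ‖x‖) ^ (-(2 : ℝ))) 2 volume := by
    have hint : Integrable (fun x : EuclideanSpace ℝ (Fin 3) => (1 + ‖x‖) ^ (-(4 : ℝ))) volume := by
      have := integrable_one_add_norm (E := EuclideanSpace ℝ (Fin 3)) (μ := volume) (r := 4)
        (by norm_num [finrank_euclideanSpace])
      simpa using this
    have h2 : MemLp (fun x : EuclideanSpace ℝ (Fin 3) => (1 + ‖x‖) ^ (-(2 : ℝ))) 2 volume := by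
      have hmeas : AEStronglyMeasurable (fun x : EuclideanSpace ℝ (Fin 3) => (1 + ‖x‖) ^ (-(2 : ℝ))) volume :=
        ((continuous_const.add continuous_norm).rpow_const fun x =>
          Or.inl (by positivity : (0 : ℝ) < 1 + ‖x‖).ne').aestronglyMeasurable
      refine (memLp_two_iff_integrable_sq hmeas).2 ?_
      refine hint.congr (ae_of_all _ fun x => ?_)
      have hx : 0 ≤ 1 + ‖x‖ := by positivity
      show (1 + ‖x‖) ^ (-(4 : ℝ)) = ((1 + ‖x‖) ^ (-(2 : ℝ))) ^ (2 : ℕ)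
      rw [← Real.rpow_natCast ((1 + ‖x‖) ^ (-(2 : ℝ))) 2, ← Real.rpow_mul hx]
      norm_num
    exact h2.const_mul C
  exact hmaj.of_le hcont.aestronglyMeasurable (ae_of_all _ fun x => by
    rw [Real.norm_eq_abs, abs_of_nonneg (by positivity)]; exact hpt x)

/-- **`ClayDelta → Corollary16 → clayR3.RegularityAt 1`**: Clay (A) at viscosity `1` from the printed corollary
plus the delta (the tree's `ClayVariants.clayR3_regularityAt_iff` then gives every `ν > 0`, i.e. the summit
statement, by the ν-scaling — not restated here). Without `ClayDelta` the implication is not derivable from the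
printed sentence (no pressure, no energy bound). [claim: Cui2012NSLpWithdrawn, status: disputed] -/
theorem clay_of_corollary16_of_delta (hΔ : ClayDelta) (hC : Corollary16) :
    ClayVariants.clayR3.RegularityAt 1 := by
  intro u₀ hs hdiv hdecay
  have hH : ∀ n : ℕ, MemLp (iteratedFDeriv ℝ n u₀) 2 volume :=
    memLp_iteratedFDeriv_of_hasRapidSpatialDecay hs hdecay
  have hL2 : MemLp u₀ 2 volume :=
    (hH 0).of_le hs.continuous.aestronglyMeasurable (ae_of_all _ fun x => by rw [norm_iteratedFDeriv_zero])
  have hw : IsWeaklyDivFree u₀ :=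
    VectorCalculus.IsDivFree.isWeaklyDivFree_holds hdiv (hs.of_le (by exact_mod_cast le_top))
  obtain ⟨u, hu⟩ := hΔ.1 1 one_pos u₀ hL2 hw
  obtain ⟨v, hv, hv0, hae⟩ := hC u₀ hs hH hdiv u hu
  obtain ⟨pr, hpr, hns, hE⟩ := hΔ.2 u₀ v hs hdiv hdecay hv hv0 ⟨u, hu, hae⟩
  exact ⟨v, pr, hv, hpr, hns, hE⟩

/-! ### v2 (append): Assertion 1 AS PRINTED (zero neighbourhood + relative `ε`), the abstract grain (F15), and the
compositions over the printed forms — asked by refuter-8 / ref-4 (INBOX 17:42–17:45Z) -/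

/-- "there is a neighborhood of `v₀ = 0` which is contained in `G_p`" (p. 14 l. 4–5, via Lemma 2.2): an absolute
`‖·‖_p`/`‖·‖₂` ball around the zero datum lies in `G`. [cite: Cui2012NSLpWithdrawn, §4 p.14] -/
def HasZeroNbhd (p : ℝ) (G : Set (EuclideanSpace ℝ (Fin 3) → EuclideanSpace ℝ (Fin 3))) : Prop :=
  ∃ ε : ℝ, 0 < ε ∧ ∀ u₀, IsData p u₀ → lpNorm p u₀ < ENNReal.ofReal ε → lpNorm 2 u₀ < ENNReal.ofReal ε → u₀ ∈ G

/-- Openness at every point of `G` in the RELATIVE form the print uses (p. 14 l. 8–10: "if `u₀` … is so close to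
`v₀` that `‖u₀ − v₀‖_p ≤ ε‖v₀‖_p` and `‖u₀ − v₀‖₂ ≤ ε‖v₀‖₂`", with `ε` depending on `v₀` through Lemma 3.2).
[cite: Cui2012NSLpWithdrawn, §4 p.14] -/
def IsRelOpenInData (p : ℝ) (G : Set (EuclideanSpace ℝ (Fin 3) → EuclideanSpace ℝ (Fin 3))) : Prop :=
  ∀ v₀ ∈ G, ∃ ε : ℝ, 0 < ε ∧ ∀ u₀, IsData p u₀ →
    lpNorm p (u₀ - v₀) ≤ ENNReal.ofReal ε * lpNorm p v₀ → lpNorm 2 (u₀ - v₀) ≤ ENNReal.ofReal ε * lpNorm 2 v₀ →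
    u₀ ∈ G

/-- **Step 5 — Assertion 1 (p. 14 l. 3–12) AS PRINTED, fixed-constant reading**: "If `v₀ = 0` then by Lemma 2.2 we
see that there is a neighborhood of `v₀` which is contained in `G_p`. … if `u₀ … ‖u₀ − v₀‖_p ≤ ε‖v₀‖_p` and
`‖u₀ − v₀‖₂ ≤ ε‖v₀‖₂`, then … we obtain a global `L^p ∩ L²`-solution … The estimate (4.1) follows from (3.1) and
(3.8) by using the inequalities `(1−ε)‖v₀‖_p ≤ ‖u₀‖_p ≤ (1+ε)‖v₀‖_p` and choosing `ε` sufficiently small" — i.e.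
membership in `G_p` WITH THE SAME `C[·]` for every relatively-`ε`-close datum, `ε = ε(v₀)`. Supersedes the v1
absolute-ball variant `Assertion1` for the verdict (same topology). [claim: Cui2012NSLpWithdrawn, status: disputed] -/
def Assertion1Printed (p : ℝ) (C : ℝ → ℝ) : Prop :=
  HasZeroNbhd p (goodSet p C) ∧ IsRelOpenInData p (goodSet p C)

/-- **Step 5′ AS PRINTED, existential reading** (zero neighbourhood + relative openness of `goodSetExists p`; the
content Lemma 3.2 actually delivers). [claim: Cui2012NSLpWithdrawn, status: disputed] -/
def Assertion1ExistsPrinted (p : ℝ) : Prop :=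
  HasZeroNbhd p (goodSetExists p) ∧ IsRelOpenInData p (goodSetExists p)

/-- **Step 5, abstract grain (F15)** — the real-number inference that p. 14 l. 10–12 reduces to at a base point whose
perturbation keeps the `κ_p`-value (so the SAME number `c = C[κ_p(v₀)] = C[κ_p(u₀)]` is required), in the
quantifier order in which Lemma 3.2 hands `ε` to p. 14: first the base `(p, c, A, B)` with (3.1) `A ≤ cB^p`
(`A = ∫‖v‖_p^{…}`, `B = ‖v₀‖_p`), then `ε₀`, then the perturbed data (`A′ = ∫‖u‖_p^{…} ≤ (1+η)A + δ` from (3.8) +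
Minkowski, `(1−ε)B ≤ B′ = ‖u₀‖_p`), conclusion (4.1) for `u₀`: `A′ ≤ cB′^p`. (The other order is provable and
carries no content.) [claim: Cui2012NSLpWithdrawn, status: disputed] -/
def Assertion1Inference : Prop :=
  ∀ p c A B : ℝ, 3 < p → 0 < B → 0 ≤ A → A ≤ c * B ^ p →
    ∃ ε₀ : ℝ, 0 < ε₀ ∧ ∀ A' B' ε η δ : ℝ, 0 ≤ ε → ε ≤ ε₀ → 0 ≤ η → η ≤ ε₀ → 0 ≤ δ → δ ≤ ε₀ →
      A' ≤ (1 + η) * A + δ → (1 - ε) * B ≤ B' → A' ≤ c * B' ^ p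

/-- **Step 6′, abstract grain (F15, existential reading only)** — "where `M = sup_n C[κ_p(u₀ₙ)]‖u₀ₙ‖_p < ∞`"
(p. 14 l. 17) from the finiteness of each term: every sequence of nonnegative reals is bounded.
[claim: Cui2012NSLpWithdrawn, status: disputed] -/
def Assertion2Inference : Prop :=
  ∀ a : ℕ → ℝ, (∀ n, 0 ≤ a n) → ∃ M : ℝ, ∀ n, a n ≤ M

/-- **Step 7 AS PRINTED** (p. 14 l. 23–24): a neighbourhood of the zero datum in `G`, relative openness at every
point of `G` and sequential closedness give every datum (classical: continuous induction along `s ↦ s·u₀`,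
`s ∈ [0,1]`). Supersedes the v1 absolute-ball variant `ContinuousInduction`. [cite: Cui2012NSLpWithdrawn, §4 p.14] -/
def ContinuousInductionPrinted (p : ℝ) (G : Set (EuclideanSpace ℝ (Fin 3) → EuclideanSpace ℝ (Fin 3))) : Prop :=
  HasZeroNbhd p G → IsRelOpenInData p G → IsSeqClosedInData p G → ∀ u₀, IsData p u₀ → u₀ ∈ G

/-- **Composition over the printed forms, FIXED reading** (Steps 1–7 in order ⇒ `ClaimedTheorem`).
[claim: Cui2012NSLpWithdrawn, status: disputed] -/
theorem claim_of_steps_printed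
    (h1 : ∀ p : ℝ, 3 < p → Theorem11 p) (_h2 : ∀ p : ℝ, 3 < p → Lemma22 p)
    (h3 : ∀ p : ℝ, 3 < p → Lemma23 p) (_h4 : ∀ p : ℝ, 3 < p → Lemma32 p)
    (h567 : ∀ p : ℝ, 3 < p → ∃ C : ℝ → ℝ,
      Assertion1Printed p C ∧ Assertion2 p C ∧ ContinuousInductionPrinted p (goodSet p C)) :
    ClaimedTheorem := by
  intro p hp
  obtain ⟨C, ⟨h0, hA1⟩, hA2, hCI⟩ := h567 p hp
  exact headline_of_goodSet (h1 p hp) (h3 p hp) (hCI h0 hA1 hA2)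

/-- **Composition over the printed forms, EXISTENTIAL reading**: only `GlobalExistence p`.
[claim: Cui2012NSLpWithdrawn, status: disputed] -/
theorem globalExistence_of_steps_exists_printed {p : ℝ} (hA1 : Assertion1ExistsPrinted p)
    (hA2 : Assertion2Exists p) (hCI : ContinuousInductionPrinted p (goodSetExists p)) : GlobalExistence p :=
  fun u₀ hu₀ => by
    obtain ⟨-, u, hu, -⟩ := hCI hA1.1 hA1.2 hA2 u₀ hu₀
    exact ⟨u, hu⟩

/-! ### v3 (append): Step 7 is a THEOREM — continuous induction along the segment `s ↦ s • u₀` -/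

/-- Scalar multiples of a datum are data. [cite: Cui2012NSLpWithdrawn, §1 p.3] -/
theorem isData_smul {p : ℝ} {u₀ : EuclideanSpace ℝ (Fin 3) → EuclideanSpace ℝ (Fin 3)} (h : IsData p u₀)
    (s : ℝ) : IsData p (s • u₀) := by
  refine ⟨h.1.const_smul s, h.2.1.const_smul s, fun θ hθ => ?_⟩
  have h0 := h.2.2 θ hθ
  simp only [Pi.smul_apply, real_inner_smul_left, integral_const_mul, h0, mul_zero]

/-- `‖s • u₀‖_q = |s| ‖u₀‖_q`. [cite: Cui2012NSLpWithdrawn, §1 p.3] -/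
theorem lpNorm_smul (q s : ℝ) (u₀ : EuclideanSpace ℝ (Fin 3) → EuclideanSpace ℝ (Fin 3)) :
    lpNorm q (s • u₀) = ‖s‖ₑ * lpNorm q u₀ :=
  eLpNorm_const_smul s u₀ _ _

/-- `‖s • u₀ − x • u₀‖_q = |s − x| ‖u₀‖_q`. [cite: Cui2012NSLpWithdrawn, §1 p.3] -/
theorem lpNorm_smul_sub_smul (q s x : ℝ) (u₀ : EuclideanSpace ℝ (Fin 3) → EuclideanSpace ℝ (Fin 3)) :
    lpNorm q (s • u₀ - x • u₀) = ‖s - x‖ₑ * lpNorm q u₀ := by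
  rw [← sub_smul]; exact lpNorm_smul q (s - x) u₀

/-- **Step 7 (as printed) is a theorem** (p. 14 l. 23–24, "we conclude that `G_p = L^p_ω ∩ L²_ω`"): a
neighbourhood of `0` in `G`, relative openness at every point of `G` and sequential closedness force every
datum into `G` — continuous induction on the parameter `s ∈ [0,1]` of the segment `s ↦ s • u₀` (the set
`{s : s • u₀ ∈ G}` contains `0`, is closed, and is a right-neighbourhood of each of its points in `[0,1)`).
So the composition `claim_of_steps_printed` needs only Steps 1–6. [cite: Cui2012NSLpWithdrawn, §4 p.14] -/
theorem continuousInductionPrinted_holds (p : ℝ)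
    (G : Set (EuclideanSpace ℝ (Fin 3) → EuclideanSpace ℝ (Fin 3))) : ContinuousInductionPrinted p G := by
  intro h0 hrel hcl u₀ hu₀
  set S : Set ℝ := {s | s • u₀ ∈ G} with hS
  have hNp : lpNorm p u₀ < ⊤ := hu₀.1.eLpNorm_lt_top
  have hN2 : lpNorm 2 u₀ < ⊤ := by
    have := hu₀.2.1.eLpNorm_lt_top
    simpa [lpNorm] using this
  -- the norms of `s • u₀` tend to `0` as `s → 0`
  have ht : ∀ q : ℝ, lpNorm q u₀ < ⊤ → Tendsto (fun s : ℝ => lpNorm q (s • u₀)) (𝓝 0) (𝓝 0) := by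
    intro q hq
    have h1 : Tendsto (fun s : ℝ => ‖s‖ₑ) (𝓝 0) (𝓝 0) := by
      simpa using (continuous_enorm.tendsto (0 : ℝ))
    have h2 := ENNReal.Tendsto.mul_const h1 (Or.inr hq.ne)
    rw [zero_mul] at h2
    exact h2.congr' (Eventually.of_forall fun s => (lpNorm_smul q s u₀).symm)
  -- `S` is a neighbourhood of `0` (the zero-neighbourhood clause)
  have h0S : S ∈ 𝓝 (0 : ℝ) := by
    obtain ⟨ε, hε, hball⟩ := h0
    have hε' : (0 : ℝ≥0∞) < ENNReal.ofReal ε := ENNReal.ofReal_pos.mpr hε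
    filter_upwards [(ht p hNp).eventually_lt_const hε', (ht 2 hN2).eventually_lt_const hε'] with s hs1 hs2
    exact hball _ (isData_smul hu₀ s) hs1 hs2
  have h0mem : (0 : ℝ) ∈ S := mem_of_mem_nhds h0S
  -- `S` is closed (sequential closedness of `G`)
  have hclosed : IsClosed S := by
    refine isSeqClosed_iff_isClosed.mp fun sq s hsq hlim => ?_
    refine hcl (fun n => sq n • u₀) (s • u₀) hsq (isData_smul hu₀ s) ?_
    have hT : Tendsto (fun n => ‖sq n - s‖ₑ) atTop (𝓝 0) := by
      have := (continuous_enorm.tendsto (0 : ℝ)).comp (tendsto_sub_nhds_zero_iff.mpr hlim)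
      rw [enorm_zero] at this
      exact this
    have h1 := ENNReal.Tendsto.mul_const hT (Or.inr hNp.ne)
    have h2 := ENNReal.Tendsto.mul_const hT (Or.inr hN2.ne)
    rw [zero_mul] at h1 h2
    have h12 := h1.add h2
    rw [add_zero] at h12
    refine h12.congr' (Eventually.of_forall fun n => ?_)
    simp only [lpNorm_smul_sub_smul]
  -- `S` is a right-neighbourhood of each of its points in `[0,1)` (relative openness; at `0` the clause above)
  have hright : ∀ x ∈ S ∩ Ico (0 : ℝ) 1, S ∈ 𝓝[>] x := by
    rintro x ⟨hxS, hx0, -⟩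
    rcases hx0.eq_or_lt with h | hxpos
    · rw [← h]; exact mem_nhdsWithin_of_mem_nhds h0S
    obtain ⟨ε, hε, hball⟩ := hrel (x • u₀) hxS
    have hsub : Ioo x (x + ε * x) ⊆ S := by
      intro s ⟨hxs, hsx⟩
      have hsx' : ‖s - x‖ₑ ≤ ENNReal.ofReal ε * ‖x‖ₑ := by
        rw [Real.enorm_eq_ofReal_abs, Real.enorm_eq_ofReal_abs, ← ENNReal.ofReal_mul hε.le]
        refine ENNReal.ofReal_le_ofReal ?_
        rw [abs_of_nonneg (by linarith), abs_of_pos hxpos]; linarith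
      have hle : ∀ q : ℝ, lpNorm q (s • u₀ - x • u₀) ≤ ENNReal.ofReal ε * lpNorm q (x • u₀) := by
        intro q
        rw [lpNorm_smul_sub_smul, lpNorm_smul, ← mul_assoc]
        exact mul_le_mul_left hsx' _
      exact hball _ (isData_smul hu₀ s) (hle p) (hle 2)
    exact mem_of_superset (Ioo_mem_nhdsGT (by nlinarith)) hsub
  have h1 : (1 : ℝ) ∈ S :=
    IsClosed.Icc_subset_of_forall_mem_nhdsWithin (hclosed.inter isClosed_Icc) h0mem hright
      ⟨zero_le_one, le_rfl⟩
  simpa [hS] using h1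

/-! ### v4 (append, D-0026 debt pass 2026-08-27): the v1 absolute-ball Step 7 `ContinuousInduction` is a THEOREM too -/

/-- **Step 7, v1 absolute-ball form, is a theorem**: `0 ∈ G`, openness of `G` by absolute `‖·‖_p`/`‖·‖₂` balls
(`IsOpenInData`) and sequential closedness (`IsSeqClosedInData`) force every datum into `G`. Reduction to the
printed form `continuousInductionPrinted_holds` applied to `G ∩ {data}`: the absolute ball at `0 ∈ G` IS a zero
neighbourhood, and at a datum `v₀ ∈ G` (finite norms) the relative ball of radius `ε/(‖v₀‖_p + ‖v₀‖₂ + 1)` lies in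
the absolute ball of radius `ε`. Both compositions that consume Step 7 (`claim_of_steps`,
`globalExistence_of_steps_exists`) thus need one hypothesis fewer; the VERDICT of record (#2: first failing step =
`Assertion1Inference`, p.14, unfilled gap, UG CONFIRMED) is untouched. [cite: Cui2012NSLpWithdrawn, §4 p.14] -/
theorem continuousInduction_holds (p : ℝ)
    (G : Set (EuclideanSpace ℝ (Fin 3) → EuclideanSpace ℝ (Fin 3))) : ContinuousInduction p G := by
  intro h0 hopen hcl u₀ hu₀
  set G' : Set (EuclideanSpace ℝ (Fin 3) → EuclideanSpace ℝ (Fin 3)) := G ∩ {v | IsData p v} with hG'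
  suffices h : u₀ ∈ G' from h.1
  refine continuousInductionPrinted_holds p G' ?_ ?_ ?_ u₀ hu₀
  · -- zero neighbourhood: the absolute ball at `0 ∈ G`
    obtain ⟨ε, hε, hball⟩ := hopen 0 h0
    refine ⟨ε, hε, fun v hv h1 h2 => ⟨hball v hv ?_ ?_, hv⟩⟩
    · simpa using h1
    · simpa using h2
  · -- relative openness at data points of `G`
    rintro v₀ ⟨hv₀G, hv₀⟩
    obtain ⟨ε, hε, hball⟩ := hopen v₀ hv₀G
    have hNp : lpNorm p v₀ < ⊤ := hv₀.1.eLpNorm_lt_top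
    have hN2 : lpNorm 2 v₀ < ⊤ := by
      have := hv₀.2.1.eLpNorm_lt_top
      simpa [lpNorm] using this
    set K : ℝ := (lpNorm p v₀).toReal + (lpNorm 2 v₀).toReal + 1 with hK
    have hK0 : 0 < K := by rw [hK]; positivity
    refine ⟨ε / (2 * K), by positivity, fun u hu h1 h2 => ⟨hball u hu ?_ ?_, hu⟩⟩
    · refine lt_of_le_of_lt h1 ?_
      rw [← ENNReal.ofReal_toReal hNp.ne, ← ENNReal.ofReal_mul (by positivity)]
      refine ENNReal.ofReal_lt_ofReal_iff_of_nonneg (by positivity) |>.2 ?_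
      have hle : (lpNorm p v₀).toReal ≤ K := by rw [hK]; linarith [ENNReal.toReal_nonneg (a := lpNorm 2 v₀)]
      calc ε / (2 * K) * (lpNorm p v₀).toReal ≤ ε / (2 * K) * K :=
            mul_le_mul_of_nonneg_left hle (by positivity)
        _ = ε / 2 := by field_simp
        _ < ε := by linarith
    · refine lt_of_le_of_lt h2 ?_
      rw [← ENNReal.ofReal_toReal hN2.ne, ← ENNReal.ofReal_mul (by positivity)]
      refine ENNReal.ofReal_lt_ofReal_iff_of_nonneg (by positivity) |>.2 ?_
      have hle : (lpNorm 2 v₀).toReal ≤ K := by rw [hK]; linarith [ENNReal.toReal_nonneg (a := lpNorm p v₀)]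
      calc ε / (2 * K) * (lpNorm 2 v₀).toReal ≤ ε / (2 * K) * K :=
            mul_le_mul_of_nonneg_left hle (by positivity)
        _ = ε / 2 := by field_simp
        _ < ε := by linarith
  · -- sequential closedness of `G ∩ {data}`
    intro s v hs hv hlim
    exact ⟨hcl s v (fun n => (hs n).1) hv hlim, hv⟩

/-- Hence the v1 fixed-constant composition needs Steps 1, 3, the base point and Assertions 1–2 only.
[claim: Cui2012NSLpWithdrawn, status: disputed] -/
theorem claim_of_steps' (h1 : ∀ p : ℝ, 3 < p → Theorem11 p) (h3 : ∀ p : ℝ, 3 < p → Lemma23 p)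
    (h56 : ∀ p : ℝ, 3 < p → ∃ C : ℝ → ℝ,
      (0 : EuclideanSpace ℝ (Fin 3) → EuclideanSpace ℝ (Fin 3)) ∈ goodSet p C ∧
        Assertion1 p C ∧ Assertion2 p C) :
    ClaimedTheorem := by
  intro p hp
  obtain ⟨C, h0, hA1, hA2⟩ := h56 p hp
  exact headline_of_goodSet (h1 p hp) (h3 p hp) (continuousInduction_holds p _ h0 hA1 hA2)

/-- And the existential composition needs the base point and Assertions 1′–2′ only.
[claim: Cui2012NSLpWithdrawn, status: disputed] -/
theorem globalExistence_of_steps_exists' {p : ℝ}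
    (h0 : (0 : EuclideanSpace ℝ (Fin 3) → EuclideanSpace ℝ (Fin 3)) ∈ goodSetExists p)
    (hA1 : Assertion1Exists p) (hA2 : Assertion2Exists p) : GlobalExistence p :=
  globalExistence_of_steps_exists h0 hA1 hA2 (continuousInduction_holds p _)


/-! ### `ClayDelta` discharged (APPEND-ONLY, cell `ns-claims` lit-4 g6, 2026-08-27): the Clay link of
Corollary 1.6 is unconditional in its classical bridge

Both conjuncts of `ClayDelta` are theorems of the tree: (a) Leray's existence theorem on `ℝ³`
(`leray_existence_R3_holds`); (b) a field `v` smooth on the closed half-space whose slices agree a.e. with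
a global Leray–Hopf solution `u` from a Clay datum is continuous, so `u` is essentially bounded on a
parabolic cylinder below every point of positive time; the tree's datum-wise bridge
`clay_solution_of_locallyBounded_globalLerayHopf` (Kato maximal time + Lemarié-Rieusset's singular point,
`BoundedLerayHopfClay.lean`) then yields a Clay-sense solution `(U, P)` from the datum, and weak–strong
uniqueness against Leray–Hopf solutions (`IsNavierStokesSolution.ae_eq_of_isLerayHopfOn`) with continuity
of the slices forces `v = U` on `t ≥ 0`, so `(v, P)` solves (1)(2)(3) classically with bounded energy. -/

/-- A field smooth on the closed half-space `[0,∞) × ℝ³` bounds, on a backward parabolic cylinder below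
every point `(T, x)` with `T > 0`, every field agreeing with it a.e. on the strips `(0, T') × ℝ³`
(continuity on the compact `[T/2, T] × B̄(x, 1)`; radius `r = min 1 √(T/2)`). [folklore] -/
private theorem eLpNorm_parabolicCylinder_lt_top_of_ae_eq_smooth
    {v u : ℝ → EuclideanSpace ℝ (Fin 3) → EuclideanSpace ℝ (Fin 3)} (hv : IsSmoothOnHalfSpace v)
    (hae : ∀ T' : ℝ, 0 < T' → uncurry u =ᵐ[volume.restrict (Ioo 0 T' ×ˢ univ)] uncurry v)
    {T : ℝ} (hT : 0 < T) (x : EuclideanSpace ℝ (Fin 3)) :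
    ∃ r : ℝ, 0 < r ∧ eLpNorm (uncurry u) ⊤ (volume.restrict (parabolicCylinder r ((T : ℝ), x))) < ⊤ := by
  -- the radius: `r ≤ 1`, `r² ≤ T/2`
  set r : ℝ := min 1 (Real.sqrt (T / 2)) with hr_def
  have hr0 : 0 < r := lt_min one_pos (Real.sqrt_pos.2 (by positivity))
  have hr1 : r ≤ 1 := min_le_left _ _
  have hr2 : r ^ 2 ≤ T / 2 := by
    calc r ^ 2 ≤ Real.sqrt (T / 2) ^ 2 := pow_le_pow_left₀ hr0.le (min_le_right _ _) 2
      _ = T / 2 := Real.sq_sqrt (by positivity)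
  -- a bound for `v` on the compact `[T/2, T] × B̄(x, 1)`
  set K : Set (ℝ × EuclideanSpace ℝ (Fin 3)) := Icc (T / 2) T ×ˢ Metric.closedBall x 1 with hK
  have hKc : IsCompact K := isCompact_Icc.prod (isCompact_closedBall x 1)
  have hKsub : K ⊆ Ici (0 : ℝ) ×ˢ (univ : Set (EuclideanSpace ℝ (Fin 3))) :=
    prod_mono (fun s hs => mem_Ici.2 (by linarith [hs.1])) (subset_univ _)
  obtain ⟨M, hM⟩ := hKc.exists_bound_of_continuousOn (hv.continuousOn.mono hKsub)
  refine ⟨r, hr0, ?_⟩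
  -- the cylinder lies in the strip `(0, T + 1) × ℝ³` and in `K`
  have hQsub : parabolicCylinder r ((T : ℝ), x) ⊆
      Ioo 0 (T + 1) ×ˢ (univ : Set (EuclideanSpace ℝ (Fin 3))) := by
    intro z hz
    obtain ⟨s, y⟩ := z
    rw [mem_parabolicCylinder] at hz
    exact mem_prod.2 ⟨⟨by linarith [hz.1.1, hr2], by linarith [hz.1.2]⟩, mem_univ _⟩
  have hQK : ∀ z ∈ parabolicCylinder r ((T : ℝ), x), z ∈ K := by
    intro z hz
    obtain ⟨s, y⟩ := z
    rw [mem_parabolicCylinder] at hz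
    exact mem_prod.2 ⟨⟨by linarith [hz.1.1, hr2], hz.1.2.le⟩, Metric.mem_closedBall.2 (hz.2.le.trans hr1)⟩
  have hae' : ∀ᵐ z ∂(volume.restrict (parabolicCylinder r ((T : ℝ), x))), uncurry u z = uncurry v z :=
    ae_restrict_of_ae_restrict_of_subset hQsub (hae (T + 1) (by linarith))
  rw [eLpNorm_exponent_top]
  refine eLpNormEssSup_lt_top_of_ae_bound (C := M) ?_
  filter_upwards [hae', ae_restrict_mem (isOpen_parabolicCylinder r ((T : ℝ), x)).measurableSet]
    with z hz hzQ
  rw [hz]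
  exact hM z (hQK z hzQ)

/-- **`ClayDelta` HOLDS**: Leray's existence theorem on `ℝ³` is a theorem of the tree, and a smooth
representative (on the closed half-space) of a global Leray–Hopf solution from a Clay datum carries a smooth
pressure making it a solution of (1)(2)(3) in Fefferman's class with bounded energy (7) — it coincides on
`t ≥ 0` with the Clay solution produced from the datum by the locally-bounded Leray–Hopf bridge.
[cite: LemarieRieusset2016, Thm. 15.1 (C), Prop. 12.3] [cite: Leray1934, §33] [cite: FeffermanClay2006, (A) with (1)–(4), (6), (7) p. 1–2] -/
theorem clayDelta_holds : ClayDelta := by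
  refine ⟨leray_existence_R3_holds, ?_⟩
  intro u₀ v hu₀ hdiv hdec hv hv0 hLH
  obtain ⟨u, hu, hvu⟩ := hLH
  have hv' : IsSmoothSpaceTimeOn (Ici 0) v := hv
  -- `u = v` a.e. on every strip `(0, T') × ℝ³`
  have hae : ∀ T' : ℝ, 0 < T' → uncurry u =ᵐ[volume.restrict (Ioo 0 T' ×ˢ univ)] uncurry v := by
    intro T' hT'
    refine ae_restrict_prod_of_forall_ae_eq (fun t ht => (hvu t ht.1.le).symm)
      (hu.isLerayHopfOn hT').weak.1 ?_
    exact (hv.continuousOn.mono (prod_mono (Ioo_subset_Ioi_self.trans Ioi_subset_Ici_self)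
      Subset.rfl)).aestronglyMeasurable (measurableSet_Ioo.prod MeasurableSet.univ)
  -- Step 1: the Clay solution from `u₀` (locally bounded Leray–Hopf ⇒ Clay)
  obtain ⟨U, P, hU, hP, hns, hE⟩ :=
    clay_solution_of_locallyBounded_globalLerayHopf one_pos hu₀ hdiv hdec hu
      (fun T hT x => eLpNorm_parabolicCylinder_lt_top_of_ae_eq_smooth hv hae hT x)
  have hU' : IsSmoothSpaceTimeOn (Ici 0) U := hU
  -- Step 2: `v = U` on `t ≥ 0` (weak–strong uniqueness + continuity of the slices)
  have hvU : ∀ t : ℝ, 0 ≤ t → v t = U t := by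
    intro t ht
    rcases ht.eq_or_lt with h0 | htpos
    · rw [← h0, hv0, hns.initial]
    · have h1 : u t =ᵐ[volume] U t :=
        IsNavierStokesSolution.ae_eq_of_isLerayHopfOn one_pos (by linarith : (0 : ℝ) < t + 1) hdec hns
          hU hP hE (hu.isLerayHopfOn (by linarith)) t ⟨htpos, by linarith⟩
      exact (Continuous.ae_eq_iff_eq volume (hv'.contDiff_slice (mem_Ici.2 ht)).continuous
        (hU'.contDiff_slice (mem_Ici.2 ht)).continuous).1 ((hvu t ht).trans h1)
  -- Step 3: `(v, P)` solves (1)(2)(3) and has bounded energy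
  refine ⟨P, hP, ⟨fun t ht x => ?_, fun t ht => ?_, hv0⟩, ?_⟩
  · have hd : derivWithin (fun s => v s x) (Ici 0) t = derivWithin (fun s => U s x) (Ici 0) t :=
      derivWithin_congr (fun s hs => by simp only [hvU s hs]) (by simp only [hvU t ht])
    rw [hd, hvU t ht]
    exact hns.momentum t ht x
  · rw [hvU t ht]
    exact hns.divFree t ht
  · obtain ⟨C, hC, hb⟩ := hE
    exact ⟨C, hC, fun t ht => by rw [hvU t ht]; exact hb t ht⟩


/-- **The row's Clay link, unconditional in the bridge**: Corollary 1.6 as printed implies Clay (A) at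
viscosity `1` (`clay_of_corollary16_of_delta` with `ClayDelta` discharged), hence (A) at every viscosity
(`ClayVariants.clayR3_regularityAt_iff`). [cite: FeffermanClay2006, (A) p. 2] -/
theorem clay_of_corollary16 (hC : Corollary16) : ClayVariants.clayR3.Regularity :=
  (ClayVariants.clayR3_regularityAt_iff one_pos).1 (clay_of_corollary16_of_delta clayDelta_holds hC)

end Literature.Claims.NS.Cui2012

end

-- WHAT THIS IS NOT: not a claim about NS regularity or blow-up; not a claim about any author beyond the
-- typed locator.
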